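import Mathlib
import Literature.MathematicalPhysics.QuantumFieldTheory.GaugeOSData
import HarnessLib

/-!
# Line `Sketch` of crux `ContinuumLegGivenGap` (stmt-QuantumFields-8782): the open core in LOCAL form

Support lemma for the open core `stub_uniformOnCompacts` of line `Sketch` ("H uniformly on bounded
coupling intervals"). A structured supplier of the weak-coupling lattice gap naturally delivers
β-uniformity LOCALLY — around each coupling `βc` of the tail a neighbourhood, one rate and per-pair
constants uniform on that neighbourhood (gap stability at a point). This file records, by the
finite-subcover argument on the compact interval `[β₁, b]`, that the local form implies the form the
line consumes (`UniformOnCompacts`: one rate and β-uniform per-pair constants on every bounded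
sub-interval of the tail): the common rate is `(1 + Σᵢ μᵢ⁻¹)⁻¹` over the finitely many chosen
neighbourhoods and the pair constant is the sum of the (non-negative parts of the) local ones.
Nothing posited, no `def`; pure topology of `ℝ`. [folklore]
-/

noncomputable section

open Filter Topology Metric
open Literature.MathematicalPhysics.QuantumFieldTheory

namespace Summit.QuantumFields.YangMills.Theorems.ContinuumLegGivenGap

/-- **Local β-uniformity of clustering implies β-uniformity on bounded coupling intervals.** If
around every coupling `βc ≥ β₁` there are `ε > 0`, a rate `μ > 0` and per-pair constants bounding
`|corr_{β,2S+1}(A, B; n)| ≤ C e^{-μ n}` for all `β ≥ β₁` with `|β - βc| < ε`, all `S` and `n ≤ S`,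
then on every `[β₁, b]` one rate and per-pair constants uniform in `β` work (finite subcover of the
compact interval; rate `(1 + Σᵢ μᵢ⁻¹)⁻¹`, constant `Σᵢ max(Cᵢ, 0)`). [folklore] -/
theorem uniformOnCompacts_of_locallyUniform :
    ∀ (G : Type) [Group G] [TopologicalSpace G] [IsTopologicalGroup G] [CompactSpace G]
      [MeasurableSpace G] [BorelSpace G] (r : LatticeRep G) (β₁ : ℝ),
      (∀ βc : ℝ, β₁ ≤ βc → ∃ ε : ℝ, 0 < ε ∧ ∃ μ : ℝ, 0 < μ ∧ ∀ A B : YMSpecies G, ∃ C : ℝ,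
        ∀ β : ℝ, β₁ ≤ β → |β - βc| < ε → ∀ S n : ℕ, n ≤ S →
          |latticeConnectedCorr r.ρ β (2 * S + 1) A.F B.F n| ≤ C * Real.exp (-(μ * n))) →
      ∀ b : ℝ, ∃ μ : ℝ, 0 < μ ∧ ∀ A B : YMSpecies G, ∃ C : ℝ,
        ∀ β : ℝ, β₁ ≤ β → β ≤ b → ∀ S n : ℕ, n ≤ S →
          |latticeConnectedCorr r.ρ β (2 * S + 1) A.F B.F n| ≤ C * Real.exp (-(μ * n)) := by
  intro G _ _ _ _ _ _ r β₁ hloc b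
  -- local data, indexed by the couplings of the tail
  choose ε hε μ hμ C hC using hloc
  -- the open cover of the compact interval `[β₁, b]` by the chosen neighbourhoods
  set K : Set ℝ := Set.Icc β₁ b with hK
  have hKc : IsCompact K := isCompact_Icc
  let ι := {βc : ℝ // β₁ ≤ βc}
  let U : ι → Set ℝ := fun i => ball i.1 (ε i.1 i.2)
  have hUo : ∀ i, IsOpen (U i) := fun i => isOpen_ball
  have hKU : K ⊆ ⋃ i, U i := by
    intro β hβ
    exact Set.mem_iUnion.2 ⟨⟨β, hβ.1⟩, mem_ball_self (hε β hβ.1)⟩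
  obtain ⟨t, ht⟩ := hKc.elim_finite_subcover U hUo hKU
  -- common rate: below every local rate of the finite subcover
  set ν : ℝ := (1 + ∑ i ∈ t, (μ i.1 i.2)⁻¹)⁻¹ with hν
  have hsum0 : 0 ≤ ∑ i ∈ t, (μ i.1 i.2)⁻¹ :=
    Finset.sum_nonneg fun i _ => (inv_pos.2 (hμ i.1 i.2)).le
  have hν0 : 0 < ν := by rw [hν]; exact inv_pos.2 (by linarith)
  have hνle : ∀ i ∈ t, ν ≤ μ i.1 i.2 := by
    intro i hi
    have h1 : (μ i.1 i.2)⁻¹ ≤ ∑ j ∈ t, (μ j.1 j.2)⁻¹ :=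
      Finset.single_le_sum (f := fun j : ι => (μ j.1 j.2)⁻¹)
        (fun j _ => (inv_pos.2 (hμ j.1 j.2)).le) hi
    have h2 : (μ i.1 i.2)⁻¹ ≤ 1 + ∑ j ∈ t, (μ j.1 j.2)⁻¹ := by linarith
    rw [hν]
    calc (1 + ∑ j ∈ t, (μ j.1 j.2)⁻¹)⁻¹ ≤ ((μ i.1 i.2)⁻¹)⁻¹ :=
          inv_anti₀ (inv_pos.2 (hμ i.1 i.2)) h2
      _ = μ i.1 i.2 := inv_inv _
  refine ⟨ν, hν0, fun A B => ?_⟩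
  -- pair constant: sum of the non-negative parts of the local constants
  refine ⟨∑ i ∈ t, max (C i.1 i.2 A B) 0, fun β hβ1 hβb S n hn => ?_⟩
  have hβK : β ∈ K := ⟨hβ1, hβb⟩
  obtain ⟨i, hi, hβi⟩ : ∃ i ∈ t, β ∈ U i := by
    have := ht hβK
    simp only [Set.mem_iUnion] at this
    obtain ⟨i, hi, h⟩ := this
    exact ⟨i, hi, h⟩
  have hdist : |β - i.1| < ε i.1 i.2 := by
    have : dist β i.1 < ε i.1 i.2 := mem_ball.1 hβi
    rwa [Real.dist_eq] at this
  have hloc := hC i.1 i.2 A B β hβ1 hdist S n hn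
  have hn0 : (0 : ℝ) ≤ n := Nat.cast_nonneg n
  have hexp : Real.exp (-(μ i.1 i.2 * n)) ≤ Real.exp (-(ν * n)) :=
    Real.exp_le_exp.2 (by nlinarith [hνle i hi])
  calc |latticeConnectedCorr r.ρ β (2 * S + 1) A.F B.F n|
      ≤ C i.1 i.2 A B * Real.exp (-(μ i.1 i.2 * n)) := hloc
    _ ≤ max (C i.1 i.2 A B) 0 * Real.exp (-(μ i.1 i.2 * n)) :=
        mul_le_mul_of_nonneg_right (le_max_left _ _) (Real.exp_pos _).le
    _ ≤ max (C i.1 i.2 A B) 0 * Real.exp (-(ν * n)) :=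
        mul_le_mul_of_nonneg_left hexp (le_max_right _ _)
    _ ≤ (∑ j ∈ t, max (C j.1 j.2 A B) 0) * Real.exp (-(ν * n)) :=
        mul_le_mul_of_nonneg_right
          (Finset.single_le_sum (f := fun j : ι => max (C j.1 j.2 A B) 0)
            (fun j _ => le_max_right _ _) hi) (Real.exp_pos _).le

/-- Conversely (trivially) β-uniformity on bounded intervals gives the local form with `ε = 1`.
[folklore] -/
theorem locallyUniform_of_uniformOnCompacts :
    ∀ (G : Type) [Group G] [TopologicalSpace G] [IsTopologicalGroup G] [CompactSpace G]
      [MeasurableSpace G] [BorelSpace G] (r : LatticeRep G) (β₁ : ℝ),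
      (∀ b : ℝ, ∃ μ : ℝ, 0 < μ ∧ ∀ A B : YMSpecies G, ∃ C : ℝ,
        ∀ β : ℝ, β₁ ≤ β → β ≤ b → ∀ S n : ℕ, n ≤ S →
          |latticeConnectedCorr r.ρ β (2 * S + 1) A.F B.F n| ≤ C * Real.exp (-(μ * n))) →
      ∀ βc : ℝ, β₁ ≤ βc → ∃ ε : ℝ, 0 < ε ∧ ∃ μ : ℝ, 0 < μ ∧ ∀ A B : YMSpecies G, ∃ C : ℝ,
        ∀ β : ℝ, β₁ ≤ β → |β - βc| < ε → ∀ S n : ℕ, n ≤ S →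
          |latticeConnectedCorr r.ρ β (2 * S + 1) A.F B.F n| ≤ C * Real.exp (-(μ * n)) := by
  intro G _ _ _ _ _ _ r β₁ h βc _
  obtain ⟨μ, hμ, hAB⟩ := h (βc + 1)
  refine ⟨1, one_pos, μ, hμ, fun A B => ?_⟩
  obtain ⟨C, hC⟩ := hAB A B
  refine ⟨C, fun β hβ1 hβc S n hn => hC β hβ1 ?_ S n hn⟩
  have := (abs_lt.1 hβc).2
  linarith

end Summit.QuantumFields.YangMills.Theorems.ContinuumLegGivenGap

end
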